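import Mathlib.Algebra.MvPolynomial.Derivation
import Mathlib.Algebra.MvPolynomial.Monad
import Mathlib.Algebra.Polynomial.Derivative
import Mathlib.LinearAlgebra.Matrix.NonsingularInverse
import Mathlib.LinearAlgebra.Matrix.Transvection
import Mathlib.Analysis.Matrix.Spectrum
import Mathlib.Combinatorics.Nullstellensatz
import Mathlib.Tactic.Ring
import Mathlib.Tactic.FieldSimp
import HarnessLib

/-!
# Chevalley restriction for `𝔤𝔩ₙ(ℂ)^T`: an `ad`-invariant polynomial vanishing on the diagonal vanishes

Let `T` be a finite index type and `𝔤 = 𝔤𝔩ₙ(K)^T`. We identify the symmetric algebra `S(𝔤)` with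
the polynomial algebra `K[z_{τ,a,b}]` (`Coord T n K`), the variable `z_{τ,a,b}` being the basis
vector `E^τ_{ab}`; the adjoint action of `E^τ_{cd}` on `S(𝔤)` is then the derivation `coadDer τ c d`
(`D(z_{τ',a,b}) = [τ'=τ](δ_{da} z_{τ,c,b} - δ_{cb} z_{τ,a,d})`, i.e. `Z_τ ↦ e_{dc} Z_τ - Z_τ e_{dc}`
on the generic matrices), and restriction to the diagonal Cartan subalgebra is `restrictDiag`
(kill the off-diagonal variables).

**Main theorem** (`eq_zero_of_coadDer_eq_zero_of_restrictDiag_eq_zero`, over `ℂ`): if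
`D_{E^τ_{cd}} P = 0` for all `τ, c, d` and `restrictDiag P = 0`, then `P = 0`. This is the
injectivity of the Chevalley restriction map `S(𝔤)^𝔤 → S(𝔥)` (Humphreys 1972, §23.1 and the
Appendix to §23; Bourbaki LIE VIII §8.3 Th. 1), which enters Bourbaki's proof of the
Harish-Chandra isomorphism (LIE VIII §8.5 Th. 2) through the top symbols of central elements.

## Proof

1. *Unipotent flows* (`conjSubst_transvection_eq`): for `c ≠ d` the substitution
   `σ_t : P ↦ P((1 + t e_{dc}) Z_τ (1 - t e_{dc}))` into `Coord[t]` satisfies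
   `d/dt σ_t(P) = σ_t(D_{E_{cd}} P)` (`derivative_flowSubst`; both sides are `σ_t`-derivations, so
   it suffices to check generators, where it is the identity `e(1+te)Z(1-te) - (1+te)Z(1-te)e =
   eZ(1-te) - (1+te)Ze` from `e² = 0`). Hence `D P = 0` forces `σ_t(P)` to be constant
   (characteristic zero), and evaluating at `t = s` gives invariance under the transvection
   `1 + s e_{dc}`.
2. *Torus* (`scaleSubst_eq_of_coadDer_eq_zero`): `D_{E_{cc}}` is diagonal on monomials with
   integer eigenvalue `wt_c(s)`; conjugation by `diag(v)` multiplies `z^s` by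
   `∏_c v_c^{wt_c(s)}` (`scaleFactor_eq_prod_zpow`), so `D_{E_{cc}} P = 0` for all `c` gives
   invariance under invertible diagonal matrices.
3. *`GLₙ^T`* (`conjSubst_eq`): Mathlib's `Matrix.diagonal_transvection_induction_of_det_ne_zero`.
4. *Hermitian points* (`eval_hermPt_eq_zero`): a block-Hermitian tuple is conjugate by unitaries to
   a real diagonal tuple (`Matrix.IsHermitian.conjStarAlgAut_star_eigenvectorUnitary`), where `P`
   equals its restriction, `0`.
5. *Totally real density*: the linear change of variables `hermSubst` turns "`P` vanishes on
   block-Hermitian matrices" into "`Q` vanishes on real points", so `Q = 0` by the grid lemma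
   `MvPolynomial.eq_zero_of_eval_zero_at_prod_finset`, and `P = hermSubstInv Q = 0`.

## Main definitions

* `Literature.ChevalleyGL.Coord T n K`, `genMat`, `conjSubst g`, `coadDer τ c d`, `restrictDiag T n K`.

## References

* J. E. Humphreys, *Introduction to Lie Algebras and Representation Theory*, Springer 1972,
  §23.1 and Appendix to §23 (Chevalley's restriction theorem; density of semisimple conjugates).
* N. Bourbaki, *Lie Groups and Lie Algebras, Chapters 7–9*, Ch. VIII §8.3 Th. 1, §8.5 Th. 2.
-/

noncomputable section

open MvPolynomial Matrix

namespace Literature.Algebra.Lie.ChevalleyGL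

variable {T : Type*} {n : ℕ} {K : Type*} [Field K]

/-- The index type of the coordinates `z_{τ,a,b}` on `𝔤𝔩ₙ^T`. [folklore] -/
abbrev Idx (T : Type*) (n : ℕ) : Type _ := T × Fin n × Fin n

/-- The coordinate algebra `K[z_{τ,a,b}]` (= the symmetric algebra `S(𝔤𝔩ₙ^T)`). [folklore] -/
abbrev Coord (T : Type*) (n : ℕ) (K : Type*) [CommSemiring K] : Type _ := MvPolynomial (Idx T n) K

/-- The generic matrix `Z_τ = (z_{τ,a,b})_{a,b}` of block `τ`. [folklore] -/
def genMat (τ : T) : Matrix (Fin n) (Fin n) (Coord T n K) :=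
  of fun a b ↦ X (τ, a, b)

/-- Entries of the generic matrix. [folklore] -/
@[simp]
theorem genMat_apply (τ : T) (a b : Fin n) : genMat (K := K) τ a b = X (τ, a, b) := rfl

/-! ### Conjugation substitutions -/

/-- The entries of `g_τ Z_τ g_τ⁻¹`: the substitution `z ↦ g z g⁻¹` on coordinates. [folklore] -/
def conjPoly (g : T → Matrix (Fin n) (Fin n) K) (l : Idx T n) : Coord T n K :=
  ((g l.1).map C * genMat l.1 * (g l.1)⁻¹.map C : Matrix (Fin n) (Fin n) (Coord T n K)) l.2.1 l.2.2

/-- The `K`-algebra endomorphism `P ↦ P(g Z g⁻¹)` of the coordinate algebra (block-wise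
conjugation by the tuple `g`). [folklore] -/
def conjSubst (g : T → Matrix (Fin n) (Fin n) K) : Coord T n K →ₐ[K] Coord T n K :=
  aeval (conjPoly g)

/-- `conjSubst` on a coordinate. [folklore] -/
theorem conjSubst_X (g : T → Matrix (Fin n) (Fin n) K) (l : Idx T n) :
    conjSubst g (X l) = conjPoly g l :=
  aeval_X _ _

/-- `conjSubst g` acts on the generic matrix of block `τ` by conjugation by `g τ`. [folklore] -/
theorem mapMatrix_conjSubst_genMat (g : T → Matrix (Fin n) (Fin n) K) (τ : T) :
    (conjSubst g).mapMatrix (genMat τ) = (g τ).map C * genMat τ * (g τ)⁻¹.map C := by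
  ext a b
  simp [conjSubst_X, conjPoly]

/-- Algebra endomorphisms fix constant matrices. [folklore] -/
theorem mapMatrix_map_C (f : Coord T n K →ₐ[K] Coord T n K) (m : Matrix (Fin n) (Fin n) K) :
    f.mapMatrix (m.map C) = m.map C :=
  Matrix.ext fun a b ↦ f.commutes (m a b)

/-- Conjugation substitutions compose: `P((g'g) Z (g'g)⁻¹) = (P(g' Z g'⁻¹))(g Z g⁻¹)`. [folklore] -/
theorem conjSubst_mul (g g' : T → Matrix (Fin n) (Fin n) K) :
    conjSubst (g' * g) = (conjSubst g).comp (conjSubst g') := by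
  refine MvPolynomial.algHom_ext fun l ↦ ?_
  obtain ⟨τ, a, b⟩ := l
  have eL : conjSubst (g' * g) (X (τ, a, b)) =
      (((g' * g) τ).map C * genMat τ * ((g' * g) τ)⁻¹.map C : Matrix (Fin n) (Fin n) (Coord T n K))
        a b := conjSubst_X _ _
  have eR : (conjSubst g).comp (conjSubst g') (X (τ, a, b)) =
      ((conjSubst g).mapMatrix ((g' τ).map C * genMat τ * (g' τ)⁻¹.map C)) a b := by
    rw [AlgHom.comp_apply, conjSubst_X]
    rfl
  rw [eL, eR, map_mul, map_mul, mapMatrix_map_C, mapMatrix_map_C, mapMatrix_conjSubst_genMat,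
    Pi.mul_apply, Matrix.mul_inv_rev, Matrix.map_mul, Matrix.map_mul]
  simp only [Matrix.mul_assoc]

/-- Conjugation by the identity tuple is the identity. [folklore] -/
@[simp]
theorem conjSubst_one : conjSubst (1 : T → Matrix (Fin n) (Fin n) K) = AlgHom.id K _ := by
  refine MvPolynomial.algHom_ext fun l ↦ ?_
  obtain ⟨τ, a, b⟩ := l
  rw [conjSubst_X, conjPoly, AlgHom.id_apply]
  simp [Matrix.map_one C C_0 C_1]

/-- If `P` is invariant under conjugation in each block separately, it is invariant under
conjugation by the whole tuple. [folklore] -/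
theorem conjSubst_eq_of_forall_mulSingle [Fintype T] [DecidableEq T]
    (g : T → Matrix (Fin n) (Fin n) K) (P : Coord T n K)
    (h : ∀ τ, conjSubst (Pi.mulSingle τ (g τ)) P = P) : conjSubst g P = P := by
  rw [← Finset.noncommProd_mulSingle g]
  refine Finset.noncommProd_induction _ _ _ (fun x ↦ conjSubst x P = P) (fun x y hx hy ↦ ?_)
    (by simp) fun τ _ ↦ h τ
  rw [conjSubst_mul, AlgHom.comp_apply, hx, hy]

/-! ### The coadjoint derivations -/

/-- The derivation of the coordinate algebra attached to the basis vector `E^τ_{cd}` of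
`𝔤𝔩ₙ^T` acting by `ad`: on the generic matrices, `Z_τ ↦ e_{dc} Z_τ - Z_τ e_{dc}` and `Z_{τ'} ↦ 0`
for `τ' ≠ τ` (`e_{dc}` the elementary matrix; note `[E_{cd}, E_{ab}] = δ_{da} E_{cb} - δ_{bc} E_{ad}`,
which is the `(a,b)` entry of `e_{dc} Z - Z e_{dc}`). [folklore] -/
def coadDer [DecidableEq T] (τ : T) (c d : Fin n) : Derivation K (Coord T n K) (Coord T n K) :=
  mkDerivation K fun l ↦ if l.1 = τ then
    (Matrix.single d c (1 : Coord T n K) * genMat τ - genMat τ * Matrix.single d c 1 :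
      Matrix (Fin n) (Fin n) (Coord T n K)) l.2.1 l.2.2
    else 0

/-- The coadjoint derivation on a coordinate (matrix form). [folklore] -/
theorem coadDer_X [DecidableEq T] (τ : T) (c d : Fin n) (l : Idx T n) :
    coadDer (K := K) τ c d (X l) = if l.1 = τ then
      (Matrix.single d c (1 : Coord T n K) * genMat τ - genMat τ * Matrix.single d c 1 :
        Matrix (Fin n) (Fin n) (Coord T n K)) l.2.1 l.2.2
      else 0 :=
  mkDerivation_X _ _ _

/-- `(e_{dc} Z)_{ab} = δ_{da} z_{cb}`. [folklore] -/
theorem single_mul_genMat_apply (τ : T) (d c a b : Fin n) :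
    (Matrix.single d c (1 : Coord T n K) * genMat τ : Matrix (Fin n) (Fin n) (Coord T n K)) a b =
      if d = a then X (τ, c, b) else 0 := by
  by_cases h : d = a
  · subst h
    simp
  · simp [Matrix.mul_apply, Matrix.single, h]

/-- `(Z e_{dc})_{ab} = δ_{cb} z_{ad}`. [folklore] -/
theorem genMat_mul_single_apply (τ : T) (d c a b : Fin n) :
    (genMat τ * Matrix.single d c (1 : Coord T n K) : Matrix (Fin n) (Fin n) (Coord T n K)) a b =
      if c = b then X (τ, a, d) else 0 := by
  by_cases h : c = b
  · subst h
    simp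
  · simp [Matrix.mul_apply, Matrix.single, h]

/-- The coadjoint derivation on a variable, computed:
`D_{E^τ_{cd}} z_{τ',a,b} = [τ' = τ] (δ_{da} z_{τ,c,b} - δ_{cb} z_{τ,a,d})`. [folklore] -/
theorem coadDer_X_apply [DecidableEq T] (τ : T) (c d : Fin n) (τ' : T) (a b : Fin n) :
    coadDer (K := K) τ c d (X (τ', a, b)) = if τ' = τ then
      ((if d = a then X (τ, c, b) else 0) - (if c = b then X (τ, a, d) else 0)) else 0 := by
  rw [coadDer_X]
  dsimp only
  by_cases h : τ' = τ
  · rw [if_pos h, if_pos h, Matrix.sub_apply, single_mul_genMat_apply, genMat_mul_single_apply]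
  · rw [if_neg h, if_neg h]

/-! ### Invariance under transvections: the polynomial flow `t ↦ (1 + t e_{dc}) Z (1 - t e_{dc})` -/

section Flow

variable [DecidableEq T] (τ₀ : T) {c d : Fin n}

open Polynomial in
/-- The flow matrix `(1 + t e_{dc}) Z_{τ₀} (1 - t e_{dc})` over `Coord[t]`. [folklore] -/
def flowMat (c d : Fin n) : Matrix (Fin n) (Fin n) (Polynomial (Coord T n K)) :=
  (1 + Matrix.single d c Polynomial.X) * (genMat τ₀).map Polynomial.C *
    (1 - Matrix.single d c Polynomial.X)

/-- The substitution `P ↦ P((1 + t e_{dc}) Z_{τ₀} (1 - t e_{dc}), Z_{τ'})` into `Coord[t]`. [folklore] -/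
def flowSubst (c d : Fin n) : Coord T n K →ₐ[K] Polynomial (Coord T n K) :=
  aeval fun l ↦ if l.1 = τ₀ then flowMat (K := K) τ₀ c d l.2.1 l.2.2 else Polynomial.C (X l)

/-- The flow substitution on a coordinate. [folklore] -/
theorem flowSubst_X (l : Idx T n) :
    flowSubst (K := K) τ₀ c d (X l) =
      if l.1 = τ₀ then flowMat (K := K) τ₀ c d l.2.1 l.2.2 else Polynomial.C (X l) :=
  aeval_X _ _

/-- Leibniz rule for `Polynomial.derivative` on matrix products (entrywise derivative). [folklore] -/
theorem matrix_map_derivative_mul {R : Type*} [CommRing R] {m : Type*} [Fintype m]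
    (M N : Matrix m m (Polynomial R)) :
    (M * N).map Polynomial.derivative =
      M.map Polynomial.derivative * N + M * N.map Polynomial.derivative := by
  ext a b
  simp only [Matrix.map_apply, Matrix.mul_apply, Matrix.add_apply, ← Finset.sum_add_distrib,
    Polynomial.derivative_sum, Polynomial.derivative_mul]

/-- `single i j (-a) = -single i j a`. [folklore] -/
theorem single_neg' {R : Type*} [Ring R] {m : Type*} [DecidableEq m] (i j : m) (a : R) :
    Matrix.single i j (-a) = -Matrix.single i j a := by
  rw [eq_neg_iff_add_eq_zero, ← Matrix.single_add, neg_add_cancel, Matrix.single_zero]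

/-- The entrywise derivative of a constant matrix vanishes. [folklore] -/
theorem map_C_map_derivative {R : Type*} [CommRing R] {m : Type*} (M : Matrix m m R) :
    (M.map Polynomial.C).map Polynomial.derivative = 0 := by
  ext a b
  simp

/-- The entrywise derivative of `1 ± t e` is `± e`. [folklore] -/
theorem map_derivative_one_add_single {R : Type*} [CommRing R] {m : Type*} [DecidableEq m]
    (i j : m) :
    ((1 : Matrix m m (Polynomial R)) + Matrix.single i j Polynomial.X).map Polynomial.derivative =
      Matrix.single i j 1 ∧
    ((1 : Matrix m m (Polynomial R)) - Matrix.single i j Polynomial.X).map Polynomial.derivative =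
      -Matrix.single i j 1 := by
  have h1 : ((1 : Matrix m m (Polynomial R))).map Polynomial.derivative = 0 := by
    ext a b
    rw [Matrix.map_apply, Matrix.one_apply]
    split_ifs <;> simp
  constructor
  · rw [Matrix.map_add _ (map_add _), h1, zero_add, Matrix.map_single, Polynomial.derivative_X]
  · rw [Matrix.map_sub _ (map_sub _), h1, zero_sub, Matrix.map_single, Polynomial.derivative_X]

omit [DecidableEq T] in
/-- The derivative of the flow matrix is its commutator with `e_{dc}` (uses `e_{dc}² = 0`).
[folklore] -/
theorem flowMat_map_derivative (hcd : c ≠ d) :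
    (flowMat (K := K) τ₀ c d).map Polynomial.derivative =
      Matrix.single d c 1 * flowMat (K := K) τ₀ c d - flowMat (K := K) τ₀ c d * Matrix.single d c 1 := by
  have hsq1 : Matrix.single d c (1 : Polynomial (Coord T n K)) * Matrix.single d c Polynomial.X = 0 :=
    Matrix.single_mul_single_of_ne (h := hcd) ..
  have hsq2 : Matrix.single d c (Polynomial.X : Polynomial (Coord T n K)) * Matrix.single d c 1 = 0 :=
    Matrix.single_mul_single_of_ne (h := hcd) ..
  obtain ⟨hd1, hd2⟩ := map_derivative_one_add_single (R := Coord T n K) (m := Fin n) d c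
  have hsq1' : ∀ M : Matrix (Fin n) (Fin n) (Polynomial (Coord T n K)),
      Matrix.single d c 1 * (Matrix.single d c Polynomial.X * M) = 0 := fun M ↦ by
    rw [← Matrix.mul_assoc, hsq1, Matrix.zero_mul]
  have hsq2' : ∀ M : Matrix (Fin n) (Fin n) (Polynomial (Coord T n K)),
      Matrix.single d c Polynomial.X * (Matrix.single d c 1 * M) = 0 := fun M ↦ by
    rw [← Matrix.mul_assoc, hsq2, Matrix.zero_mul]
  rw [flowMat, matrix_map_derivative_mul, matrix_map_derivative_mul, hd1, hd2, map_C_map_derivative]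
  simp only [Matrix.mul_add, Matrix.add_mul, Matrix.mul_sub, Matrix.sub_mul, Matrix.mul_one,
    Matrix.one_mul, Matrix.mul_zero, Matrix.mul_neg, Matrix.mul_assoc, hsq2, hsq1', add_zero,
    sub_zero]
  abel

/-- `flowSubst` acts on the generic matrix of block `τ₀` by the flow matrix. [folklore] -/
theorem mapMatrix_flowSubst_genMat :
    (flowSubst (K := K) τ₀ c d).mapMatrix (genMat τ₀) = flowMat (K := K) τ₀ c d := by
  refine Matrix.ext fun a b ↦ ?_
  rw [AlgHom.mapMatrix_apply, Matrix.map_apply, genMat_apply, flowSubst, aeval_X, if_pos rfl]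

/-- The flow equation on generators: `d/dt σ_t(z) = σ_t(D z)`. [folklore] -/
theorem derivative_flowSubst_X (hcd : c ≠ d) (l : Idx T n) :
    Polynomial.derivative (flowSubst (K := K) τ₀ c d (X l)) =
      flowSubst (K := K) τ₀ c d (coadDer τ₀ c d (X l)) := by
  obtain ⟨τ, a, b⟩ := l
  rw [coadDer_X, flowSubst_X]
  dsimp only
  by_cases hτ : τ = τ₀
  · subst hτ
    rw [if_pos rfl, if_pos rfl]
    have h1 : Polynomial.derivative (flowMat (K := K) τ c d a b) =
        ((flowMat (K := K) τ c d).map Polynomial.derivative) a b := rfl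
    have h2 : flowSubst (K := K) τ c d
        ((Matrix.single d c (1 : Coord T n K) * genMat τ - genMat τ * Matrix.single d c 1 :
          Matrix (Fin n) (Fin n) (Coord T n K)) a b) =
        ((flowSubst (K := K) τ c d).mapMatrix
          (Matrix.single d c (1 : Coord T n K) * genMat τ - genMat τ * Matrix.single d c 1)) a b :=
      rfl
    have h3 : (flowSubst (K := K) τ c d).mapMatrix (Matrix.single d c (1 : Coord T n K)) =
        Matrix.single d c 1 := by
      rw [AlgHom.mapMatrix_apply, Matrix.map_single, map_one]
    rw [h1, flowMat_map_derivative τ hcd, h2, map_sub, map_mul, map_mul, mapMatrix_flowSubst_genMat,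
      h3]
  · rw [if_neg hτ, if_neg hτ, Polynomial.derivative_C, map_zero]

/-- **The flow equation**: `d/dt P((1+te)Z(1-te)) = (D_{E_{cd}} P)((1+te)Z(1-te))`. [folklore] -/
theorem derivative_flowSubst (hcd : c ≠ d) (P : Coord T n K) :
    Polynomial.derivative (flowSubst (K := K) τ₀ c d P) =
      flowSubst (K := K) τ₀ c d (coadDer τ₀ c d P) := by
  induction P using MvPolynomial.induction_on with
  | C a =>
    rw [MvPolynomial.derivation_C, map_zero, ← MvPolynomial.algebraMap_eq, AlgHom.commutes,
      Polynomial.algebraMap_apply, Polynomial.derivative_C]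
  | add p q hp hq => rw [map_add, map_add, map_add, map_add, hp, hq]
  | mul_X p l hp =>
    rw [map_mul, Polynomial.derivative_mul, hp, derivative_flowSubst_X τ₀ hcd, Derivation.leibniz,
      smul_eq_mul, smul_eq_mul, map_add, map_mul, map_mul]
    ring

/-- Evaluating the flow at `t = s` is conjugation by the transvection `1 + s e_{dc}` in block `τ₀`.
[folklore] -/
theorem eval_flowSubst (hcd : c ≠ d) (s : K) (P : Coord T n K) :
    Polynomial.eval (C s) (flowSubst (K := K) τ₀ c d P) =
      conjSubst (Pi.mulSingle τ₀ (transvection d c s)) P := by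
  have hinv : (transvection d c s)⁻¹ = transvection d c (-s) :=
    Matrix.inv_eq_left_inv (by rw [transvection_mul_transvection_same d c hcd.symm, neg_add_cancel,
      transvection_zero])
  suffices h : (Polynomial.evalRingHom (C s)).comp (flowSubst (K := K) τ₀ c d).toRingHom =
      (conjSubst (Pi.mulSingle τ₀ (transvection d c s))).toRingHom from
    RingHom.congr_fun h P
  refine MvPolynomial.ringHom_ext (fun r ↦ ?_) fun l ↦ ?_
  · rw [RingHom.comp_apply, AlgHom.toRingHom_eq_coe, AlgHom.toRingHom_eq_coe, RingHom.coe_coe,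
      RingHom.coe_coe, ← MvPolynomial.algebraMap_eq, AlgHom.commutes, AlgHom.commutes,
      Polynomial.algebraMap_apply, Polynomial.coe_evalRingHom, Polynomial.eval_C, MvPolynomial.algebraMap_eq]
  · obtain ⟨τ, a, b⟩ := l
    rw [RingHom.comp_apply, AlgHom.toRingHom_eq_coe, AlgHom.toRingHom_eq_coe, RingHom.coe_coe,
      RingHom.coe_coe, conjSubst_X, conjPoly, flowSubst_X, Polynomial.coe_evalRingHom]
    dsimp only
    have hT : ∀ r : K, (transvection d c r).map C = 1 + Matrix.single d c (C r : Coord T n K) := by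
      intro r
      rw [transvection, Matrix.map_add _ (map_add C), Matrix.map_one C C_0 C_1, Matrix.map_single]
    by_cases hτ : τ = τ₀
    · subst hτ
      rw [if_pos rfl, Pi.mulSingle_eq_same, hinv, hT, hT, map_neg, single_neg', ← sub_eq_add_neg]
      have h1 : Polynomial.eval (C s) (flowMat (K := K) τ c d a b) =
          ((Polynomial.evalRingHom (C s)).mapMatrix (flowMat (K := K) τ c d)) a b := rfl
      have h2 : (Polynomial.evalRingHom (C s)).mapMatrix
          ((1 : Matrix (Fin n) (Fin n) (Polynomial (Coord T n K))) + Matrix.single d c Polynomial.X) =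
          1 + Matrix.single d c (C s) := by
        rw [map_add, map_one, RingHom.mapMatrix_apply, Matrix.map_single, Polynomial.coe_evalRingHom,
          Polynomial.eval_X]
      have h3 : (Polynomial.evalRingHom (C s)).mapMatrix
          ((1 : Matrix (Fin n) (Fin n) (Polynomial (Coord T n K))) - Matrix.single d c Polynomial.X) =
          1 - Matrix.single d c (C s) := by
        rw [map_sub, map_one, RingHom.mapMatrix_apply, Matrix.map_single, Polynomial.coe_evalRingHom,
          Polynomial.eval_X]
      have h4 : (Polynomial.evalRingHom (C s)).mapMatrix ((genMat (n := n) (K := K) τ).map Polynomial.C) =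
          genMat τ := by
        refine Matrix.ext fun a' b' ↦ ?_
        simp
      rw [h1, flowMat, map_mul, map_mul, h2, h3, h4]
    · rw [if_neg hτ, Pi.mulSingle_eq_of_ne hτ, Polynomial.eval_C, inv_one, Matrix.map_one C C_0 C_1,
        Matrix.one_mul, Matrix.mul_one, genMat_apply]

/-- **Infinitesimal invariance integrates along unipotent flows**: if `D_{E_{cd}} P = 0`
(`c ≠ d`), then `P` is invariant under conjugation by every transvection `1 + s e_{dc}` in
block `τ₀`. [folklore] -/
theorem conjSubst_transvection_eq [CharZero K] (hcd : c ≠ d) {P : Coord T n K}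
    (hP : coadDer τ₀ c d P = 0) (s : K) :
    conjSubst (Pi.mulSingle τ₀ (transvection d c s)) P = P := by
  have h1 : Polynomial.derivative (flowSubst (K := K) τ₀ c d P) = 0 := by
    rw [derivative_flowSubst τ₀ hcd, hP, map_zero]
  have h2 := Polynomial.eq_C_of_derivative_eq_zero h1
  have h3 : (flowSubst (K := K) τ₀ c d P).coeff 0 = P := by
    rw [Polynomial.coeff_zero_eq_eval_zero, ← C_0, eval_flowSubst τ₀ hcd, transvection_zero,
      Pi.mulSingle_one, conjSubst_one, AlgHom.id_apply]
  rw [← eval_flowSubst τ₀ hcd, h2, h3, Polynomial.eval_C]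

end Flow

/-! ### Invariance under the torus: weights -/

section Torus

variable [DecidableEq T]

/-- If `D fᵢ = cᵢ fᵢ` for all `i`, then `D (∏ fᵢ) = (∑ cᵢ) ∏ fᵢ`. [folklore] -/
theorem derivation_finset_prod_of_eigen {R A : Type*} [CommRing R] [CommRing A] [Algebra R A]
    (D : Derivation R A A) {ι : Type*} (s : Finset ι) (f c : ι → A)
    (h : ∀ i ∈ s, D (f i) = c i * f i) :
    D (∏ i ∈ s, f i) = (∑ i ∈ s, c i) * ∏ i ∈ s, f i := by
  classical
  induction s using Finset.induction_on with
  | empty => simp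
  | insert a s ha ih =>
    rw [Finset.prod_insert ha, Derivation.leibniz, smul_eq_mul, smul_eq_mul,
      ih fun i hi ↦ h i (Finset.mem_insert_of_mem hi), h a (Finset.mem_insert_self a s),
      Finset.sum_insert ha]
    ring

/-- If `D f = c f`, then `D (f ^ m) = m c f ^ m`. [folklore] -/
theorem derivation_pow_of_eigen {R A : Type*} [CommRing R] [CommRing A] [Algebra R A]
    (D : Derivation R A A) (f c : A) (h : D f = c * f) (m : ℕ) :
    D (f ^ m) = (m * c) * f ^ m := by
  induction m with
  | zero => simp
  | succ m ih =>
    rw [pow_succ, Derivation.leibniz, smul_eq_mul, smul_eq_mul, ih, h, Nat.cast_succ]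
    ring

/-- A derivation of a polynomial algebra which is diagonal on the variables, `D zₗ = εₗ zₗ`, is
diagonal on monomials: `D z^s = (∑ₗ sₗ εₗ) z^s`. [folklore] -/
theorem derivation_monomial_of_eigen {σ R : Type*} [CommRing R] (D : Derivation R (MvPolynomial σ R)
    (MvPolynomial σ R)) (ε : σ → R) (hD : ∀ l, D (X l) = C (ε l) * X l) (s : σ →₀ ℕ) :
    D (monomial s 1) = C (s.sum fun l k ↦ (k : R) * ε l) * monomial s 1 := by
  rw [monomial_eq, C_1, one_mul, Finsupp.prod, derivation_finset_prod_of_eigen D _ _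
    (fun l ↦ C ((s l : R) * ε l)) fun l _ ↦ ?_, Finsupp.sum, map_sum]
  rw [derivation_pow_of_eigen D _ _ (hD l), map_mul, map_natCast]

/-- The torus weight of the multi-index `s` at the torus element `E^{τ₀}_{cc}`:
`∑_b s_{τ₀,c,b} - ∑_a s_{τ₀,a,c}`, written as a sum over `s`. [folklore] -/
def torusWt (τ₀ : T) (c : Fin n) (s : Idx T n →₀ ℕ) : ℤ :=
  s.sum fun l k ↦ (k : ℤ) *
    (if l.1 = τ₀ then ((if c = l.2.1 then 1 else 0) - (if c = l.2.2 then 1 else 0)) else 0)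

omit [DecidableEq T] in
/-- Torus weights are additive in the multi-index. [folklore] -/
theorem torusWt_add [DecidableEq T] (τ₀ : T) (c : Fin n) (s s' : Idx T n →₀ ℕ) :
    torusWt τ₀ c (s + s') = torusWt τ₀ c s + torusWt τ₀ c s' := by
  unfold torusWt
  exact Finsupp.sum_add_index' (fun _ ↦ by simp) fun _ _ _ ↦ by push_cast; ring

/-- The torus derivation `D_{E^{τ₀}_{cc}}` is diagonal on the variables. [folklore] -/
theorem coadDer_diag_X (τ₀ : T) (c : Fin n) (l : Idx T n) :
    coadDer (K := K) τ₀ c c (X l) = C (((if l.1 = τ₀ then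
      ((if c = l.2.1 then 1 else 0) - (if c = l.2.2 then 1 else 0)) else 0 : ℤ) : K)) * X l := by
  obtain ⟨τ, a, b⟩ := l
  rw [coadDer_X_apply]
  dsimp only
  by_cases hτ : τ = τ₀
  · subst hτ
    rw [if_pos rfl, if_pos rfl]
    by_cases hca : c = a <;> by_cases hcb : c = b
    · subst hca; subst hcb; simp
    · subst hca; simp [hcb]
    · subst hcb; simp [hca]
    · simp [hca, hcb]
  · rw [if_neg hτ, if_neg hτ]
    simp

/-- The torus derivation on monomials: `D_{E_{cc}} z^s = wt_c(s) z^s`. [folklore] -/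
theorem coadDer_diag_monomial (τ₀ : T) (c : Fin n) (s : Idx T n →₀ ℕ) (r : K) :
    coadDer (K := K) τ₀ c c (monomial s r) = monomial s (((torusWt τ₀ c s : ℤ) : K) * r) := by
  have h1 : coadDer (K := K) τ₀ c c (monomial s 1) = C ((torusWt τ₀ c s : ℤ) : K) * monomial s 1 := by
    rw [derivation_monomial_of_eigen _ _ (coadDer_diag_X τ₀ c) s, torusWt]
    congr 2
    rw [Finsupp.sum, Finsupp.sum, Int.cast_sum]
    refine Finset.sum_congr rfl fun l _ ↦ ?_
    push_cast
    ring
  have h2 : monomial s r = C r * monomial s 1 := by rw [C_mul_monomial, mul_one]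
  rw [h2, Derivation.leibniz, MvPolynomial.derivation_C, smul_zero, add_zero, smul_eq_mul, h1,
    ← mul_assoc, ← map_mul, C_mul_monomial, mul_one, mul_comm]

/-- If `D_{E_{cc}} P = 0` then every monomial of `P` has torus weight `0` at `c`. [folklore] -/
theorem torusWt_eq_zero_of_coadDer_eq_zero [CharZero K] {τ₀ : T} {c : Fin n} {P : Coord T n K}
    (hP : coadDer τ₀ c c P = 0) {s : Idx T n →₀ ℕ} (hs : s ∈ P.support) : torusWt τ₀ c s = 0 := by
  classical
  have key : coeff s (coadDer (K := K) τ₀ c c P) = ((torusWt τ₀ c s : ℤ) : K) * coeff s P := by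
    conv_lhs => rw [← P.support_sum_monomial_coeff, map_sum]
    simp_rw [coadDer_diag_monomial, coeff_sum, coeff_monomial]
    rw [Finset.sum_ite_eq' P.support s, if_pos hs]
  rw [hP, coeff_zero] at key
  have h := (mul_eq_zero.mp key.symm).resolve_right (mem_support_iff.mp hs)
  exact_mod_cast h

/-- The block-diagonal scaling substitution `z_{τ,a,b} ↦ v_{τ,a} v_{τ,b}⁻¹ z_{τ,a,b}`
(conjugation by the block-diagonal matrix `diag(v_τ)_τ`). [folklore] -/
def scaleSubst (v : T → Fin n → K) : Coord T n K →ₐ[K] Coord T n K :=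
  aeval fun l ↦ C (v l.1 l.2.1 * (v l.1 l.2.2)⁻¹) * X l

/-- The scaling factor of the monomial `z^s`. [folklore] -/
def scaleFactor (v : T → Fin n → K) (s : Idx T n →₀ ℕ) : K :=
  s.prod fun l k ↦ (v l.1 l.2.1 * (v l.1 l.2.2)⁻¹) ^ k

omit [DecidableEq T] in
/-- The scaling substitution multiplies a monomial by its scaling factor. [folklore] -/
theorem scaleSubst_monomial (v : T → Fin n → K) (s : Idx T n →₀ ℕ) (r : K) :
    scaleSubst v (monomial s r) = C (scaleFactor v s) * monomial s r := by
  rw [scaleSubst, aeval_monomial, algebraMap_eq, scaleFactor]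
  have : (s.prod fun l k ↦ (C (v l.1 l.2.1 * (v l.1 l.2.2)⁻¹) * X l) ^ k) =
      (s.prod fun l k ↦ C ((v l.1 l.2.1 * (v l.1 l.2.2)⁻¹) ^ k)) * s.prod fun l k ↦ X l ^ k := by
    rw [← Finsupp.prod_mul]
    refine Finset.prod_congr rfl fun l _ ↦ ?_
    show (C _ * X l) ^ (s l) = C (_ ^ (s l)) * X l ^ (s l)
    rw [mul_pow, map_pow]
  rw [this, ← map_finsuppProd, ← mul_assoc, ← map_mul, mul_comm r, map_mul, mul_assoc,
    ← monomial_eq]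

omit [DecidableEq T] in
/-- The scaling factor is multiplicative in the multi-index. [folklore] -/
theorem scaleFactor_add (v : T → Fin n → K) (s s' : Idx T n →₀ ℕ) :
    scaleFactor v (s + s') = scaleFactor v s * scaleFactor v s' :=
  Finsupp.prod_add_index' (fun _ ↦ pow_zero _) fun _ _ _ ↦ pow_add _ _ _

/-- The torus weight of a single variable power. [folklore] -/
theorem torusWt_single (τ₀ : T) (c : Fin n) (l : Idx T n) (k : ℕ) :
    torusWt τ₀ c (Finsupp.single l k) = (k : ℤ) *
      (if l.1 = τ₀ then ((if c = l.2.1 then 1 else 0) - (if c = l.2.2 then 1 else 0)) else 0) := by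
  unfold torusWt
  exact Finsupp.sum_single_index (by simp)

omit [DecidableEq T] in
/-- The scaling factor of a single variable power. [folklore] -/
theorem scaleFactor_single (v : T → Fin n → K) (l : Idx T n) (k : ℕ) :
    scaleFactor v (Finsupp.single l k) = (v l.1 l.2.1 * (v l.1 l.2.2)⁻¹) ^ k := by
  unfold scaleFactor
  exact Finsupp.prod_single_index (pow_zero _)

/-- The torus-weight product for a single variable `z_{τ,a,b}^k` is `(v_{τ,a}/v_{τ,b})^k`. [folklore] -/
theorem prod_zpow_torusWt_single [Fintype T] (v : T → Fin n → K) (hv : ∀ τ c, v τ c ≠ 0) (τ : T)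
    (a b : Fin n) (k : ℕ) :
    ∏ τ', ∏ c, v τ' c ^ torusWt τ' c (Finsupp.single (τ, a, b) k) = (v τ a * (v τ b)⁻¹) ^ k := by
  simp_rw [torusWt_single]
  rw [Finset.prod_eq_single τ (fun τ' _ hτ' ↦ by simp [Ne.symm hτ']) (by simp)]
  have key : ∀ c : Fin n,
      v τ c ^ ((k : ℤ) * (if ((τ, a, b) : Idx T n).1 = τ then
        ((if c = ((τ, a, b) : Idx T n).2.1 then 1 else 0) -
          (if c = ((τ, a, b) : Idx T n).2.2 then 1 else 0)) else 0)) =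
        (if c = a then v τ c else 1) ^ k * ((if c = b then v τ c else 1) ^ k)⁻¹ := by
    intro c
    rw [if_pos rfl, mul_comm, _root_.zpow_mul, zpow_natCast, ← inv_pow, ← mul_pow]
    congr 1
    dsimp only
    split_ifs <;> simp [mul_inv_cancel₀ (hv τ c)]
  rw [Finset.prod_congr rfl fun c _ ↦ key c, Finset.prod_mul_distrib, Finset.prod_inv_distrib,
    Finset.prod_pow, Finset.prod_pow, Finset.prod_ite_eq', Finset.prod_ite_eq', if_pos (Finset.mem_univ _),
    if_pos (Finset.mem_univ _), mul_pow, inv_pow]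

/-- **The scaling factor is governed by the torus weights**:
`∏ₗ (v_a/v_b)^{sₗ} = ∏_τ ∏_c v_{τ,c}^{wt_{τ,c}(s)}`. [folklore] -/
theorem scaleFactor_eq_prod_zpow [Fintype T] (v : T → Fin n → K) (hv : ∀ τ c, v τ c ≠ 0)
    (s : Idx T n →₀ ℕ) :
    scaleFactor v s = ∏ τ, ∏ c, v τ c ^ torusWt τ c s := by
  induction s using Finsupp.induction with
  | zero =>
    simp [scaleFactor, torusWt]
  | single_add l k s hl hk ih =>
    rw [scaleFactor_add, ih]
    simp_rw [torusWt_add, zpow_add₀ (hv _ _), Finset.prod_mul_distrib]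
    congr 1
    obtain ⟨τ, a, b⟩ := l
    rw [scaleFactor_single, prod_zpow_torusWt_single v hv]

/-- **Infinitesimal torus invariance integrates**: if all `D_{E^τ_{cc}} P = 0`, then `P` is
invariant under every block-diagonal scaling. [folklore] -/
theorem scaleSubst_eq_of_coadDer_eq_zero [Fintype T] [CharZero K] {P : Coord T n K}
    (hP : ∀ τ c, coadDer τ c c P = 0) (v : T → Fin n → K) (hv : ∀ τ c, v τ c ≠ 0) :
    scaleSubst v P = P := by
  conv_lhs => rw [← P.support_sum_monomial_coeff, map_sum]
  conv_rhs => rw [← P.support_sum_monomial_coeff]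
  refine Finset.sum_congr rfl fun s hs ↦ ?_
  rw [scaleSubst_monomial, scaleFactor_eq_prod_zpow v hv]
  rw [Finset.prod_congr rfl fun τ _ ↦ Finset.prod_congr rfl fun c _ ↦ by
    rw [torusWt_eq_zero_of_coadDer_eq_zero (hP τ c) hs, zpow_zero]]
  simp

omit [DecidableEq T] in
/-- Conjugation by a block-diagonal tuple of diagonal matrices is the scaling substitution.
[folklore] -/
theorem conjSubst_diagonal (v : T → Fin n → K) (hv : ∀ τ c, v τ c ≠ 0) :
    conjSubst (fun τ ↦ diagonal (v τ)) = scaleSubst v := by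
  refine MvPolynomial.algHom_ext fun l ↦ ?_
  obtain ⟨τ, a, b⟩ := l
  rw [conjSubst_X, conjPoly, scaleSubst, aeval_X]
  dsimp only
  have hinv : (diagonal (v τ))⁻¹ = diagonal fun c ↦ (v τ c)⁻¹ :=
    Matrix.inv_eq_right_inv (by
      rw [diagonal_mul_diagonal]
      convert diagonal_one with c
      exact mul_inv_cancel₀ (hv τ c))
  rw [hinv, diagonal_map (map_zero C), diagonal_map (map_zero C)]
  have : ((diagonal fun m ↦ C (v τ m)) * genMat τ * diagonal fun m ↦ C (v τ m)⁻¹ :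
      Matrix (Fin n) (Fin n) (Coord T n K)) a b = C (v τ a) * X (τ, a, b) * C (v τ b)⁻¹ := by
    rw [mul_diagonal, diagonal_mul, genMat_apply]
  rw [this, map_mul]
  ring

/-! ### Invariance under `GLₙ(K)^T` -/

/-- **Infinitesimal invariance implies invariance under `GLₙ(K)` in one block**: by Mathlib's
`Matrix.diagonal_transvection_induction_of_det_ne_zero` (every invertible matrix is a product of
transvections and an invertible diagonal matrix). [folklore] -/
theorem conjSubst_mulSingle_eq [Fintype T] [CharZero K] {P : Coord T n K}
    (hP : ∀ τ c d, coadDer τ c d P = 0) (τ₀ : T) (g : Matrix (Fin n) (Fin n) K) (hg : g.det ≠ 0) :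
    conjSubst (Pi.mulSingle τ₀ g) P = P := by
  refine diagonal_transvection_induction_of_det_ne_zero (fun g ↦ conjSubst (Pi.mulSingle τ₀ g) P = P)
    g hg (fun w hw ↦ ?_) (fun t ↦ ?_) fun A B _ _ hA hB ↦ ?_
  · have hw' : ∀ c, w c ≠ 0 := fun c hc ↦ hw (by
      rw [det_diagonal]
      exact Finset.prod_eq_zero (Finset.mem_univ c) hc)
    let v : T → Fin n → K := fun τ ↦ if τ = τ₀ then w else fun _ ↦ 1
    have hv : ∀ τ c, v τ c ≠ 0 := fun τ c ↦ by
      dsimp only [v]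
      split_ifs
      · exact hw' c
      · exact one_ne_zero
    have h1 : Pi.mulSingle τ₀ (diagonal w) = fun τ ↦ diagonal (v τ) := by
      funext τ
      dsimp only [v]
      by_cases hτ : τ = τ₀
      · subst hτ
        rw [Pi.mulSingle_eq_same, if_pos rfl]
      · rw [Pi.mulSingle_eq_of_ne hτ, if_neg hτ, diagonal_one]
    rw [h1, conjSubst_diagonal v hv, scaleSubst_eq_of_coadDer_eq_zero (fun τ c ↦ hP τ c c) v hv]
  · obtain ⟨i, j, hij, c⟩ := t
    rw [TransvectionStruct.toMatrix_mk]
    exact conjSubst_transvection_eq τ₀ hij.symm (hP τ₀ j i) c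
  · rw [Pi.mulSingle_mul, conjSubst_mul, AlgHom.comp_apply, hA, hB]

/-- **Infinitesimal invariance implies invariance under `GLₙ(K)^T`.** [folklore] -/
theorem conjSubst_eq [Fintype T] [CharZero K] {P : Coord T n K} (hP : ∀ τ c d, coadDer τ c d P = 0)
    (g : T → Matrix (Fin n) (Fin n) K) (hg : ∀ τ, (g τ).det ≠ 0) : conjSubst g P = P :=
  conjSubst_eq_of_forall_mulSingle g P fun τ ↦ conjSubst_mulSingle_eq hP τ (g τ) (hg τ)

end Torus

/-! ### Restriction to the diagonal -/

section Restrict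

variable (T n K) in
/-- Restriction to the Cartan subalgebra: the algebra map `K[z_{τ,a,b}] → K[x_{τ,i}]` killing the
off-diagonal coordinates and sending `z_{τ,a,a} ↦ x_{τ,a}` (restriction of polynomial functions on
`𝔤 = ∏ 𝔤𝔩ₙ` to the diagonal `𝔥`, for the identification `S(𝔤) =` polynomials on `𝔤` by the trace
form). [folklore] -/
def restrictDiag : Coord T n K →ₐ[K] MvPolynomial (T × Fin n) K :=
  aeval fun l ↦ if l.2.1 = l.2.2 then X (l.1, l.2.1) else 0

/-- Evaluating the restriction is evaluating at a point supported on the diagonal. [folklore] -/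
theorem eval_restrictDiag (y : T × Fin n → K) (P : Coord T n K) :
    eval y (restrictDiag T n K P) =
      eval (fun l : Idx T n ↦ if l.2.1 = l.2.2 then y (l.1, l.2.1) else 0) P := by
  rw [restrictDiag, MvPolynomial.eval, aeval_eq_bind₁, eval₂Hom_bind₁]
  change eval₂Hom _ _ P = eval₂Hom _ _ P
  congr 2
  funext l
  split_ifs <;> simp

/-- A polynomial evaluated at a point vanishing off the diagonal only sees its restriction.
[folklore] -/
theorem eval_eq_eval_restrictDiag {q : Idx T n → K} (hq : ∀ τ a b, a ≠ b → q (τ, a, b) = 0)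
    (P : Coord T n K) : eval q P = eval (fun p ↦ q (p.1, p.2, p.2)) (restrictDiag T n K P) := by
  rw [eval_restrictDiag]
  congr 2
  funext ⟨τ, a, b⟩
  dsimp only
  split_ifs with h
  · rw [h]
  · exact hq τ a b h

end Restrict

/-! ### Over `ℂ`: Hermitian points, and the conclusion -/

section Complex

variable [Fintype T] [DecidableEq T]

/-- The block-Hermitian point attached to a family of coordinates `y`: above the diagonal
`y_{ab} + i y_{ba}`, on it `y_{aa}`, below it `y_{ba} - i y_{ab}` (Hermitian when `y` is real).
[folklore] -/
def hermPt (y : Idx T n → ℂ) : Idx T n → ℂ := fun l ↦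
  if l.2.1 < l.2.2 then y l + Complex.I * y (l.1, l.2.2, l.2.1)
  else if l.2.1 = l.2.2 then y l else y (l.1, l.2.2, l.2.1) - Complex.I * y l

omit [Fintype T] [DecidableEq T] in
/-- For real coordinates the Hermitian point is a Hermitian matrix in each block. [folklore] -/
theorem isHermitian_hermPt (y : Idx T n → ℝ) (τ : T) :
    (Matrix.of fun a b ↦ hermPt (fun l ↦ (y l : ℂ)) (τ, a, b)).IsHermitian := by
  refine Matrix.IsHermitian.ext fun a b ↦ ?_
  simp only [Matrix.of_apply, hermPt]
  rcases lt_trichotomy a b with h | rfl | h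
  · rw [if_neg (not_lt.mpr h.le), if_neg (ne_of_gt h), if_pos h]
    simp
  · simp
  · rw [if_pos h, if_neg (not_lt.mpr h.le), if_neg (ne_of_gt h)]
    simp only [Complex.star_def, map_add, map_mul, Complex.conj_I, Complex.conj_ofReal]
    ring

/-- The substitution realising `hermPt` on polynomials. [folklore] -/
def hermSubst : Coord T n ℂ →ₐ[ℂ] Coord T n ℂ :=
  aeval fun l ↦ if l.2.1 < l.2.2 then X l + C Complex.I * X (l.1, l.2.2, l.2.1)
    else if l.2.1 = l.2.2 then X l else X (l.1, l.2.2, l.2.1) - C Complex.I * X l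

omit [Fintype T] [DecidableEq T] in
/-- Evaluating `hermSubst P` at `x` is evaluating `P` at the Hermitian point of `x`. [folklore] -/
theorem eval_hermSubst (x : Idx T n → ℂ) (P : Coord T n ℂ) :
    eval x (hermSubst P) = eval (hermPt x) P := by
  rw [hermSubst, MvPolynomial.eval, aeval_eq_bind₁, eval₂Hom_bind₁]
  change eval₂Hom _ _ P = eval₂Hom _ _ P
  congr 2
  funext l
  simp only [hermPt]
  split_ifs <;> simp

/-- The inverse substitution. [folklore] -/
def hermSubstInv : Coord T n ℂ →ₐ[ℂ] Coord T n ℂ :=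
  aeval fun l ↦ if l.2.1 < l.2.2 then C (1 / 2 : ℂ) * (X l + X (l.1, l.2.2, l.2.1))
    else if l.2.1 = l.2.2 then X l else C ((2 * Complex.I)⁻¹) * (X (l.1, l.2.2, l.2.1) - X l)

omit [Fintype T] [DecidableEq T] in
/-- `hermSubstInv` is a left inverse of `hermSubst`. [folklore] -/
theorem hermSubstInv_hermSubst (P : Coord T n ℂ) : hermSubstInv (hermSubst P) = P := by
  have e1 : (C Complex.I : Coord T n ℂ) * C ((2 * Complex.I)⁻¹) = C (1 / 2 : ℂ) := by
    rw [← map_mul, mul_inv, ← mul_assoc, mul_comm Complex.I, mul_assoc,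
      mul_inv_cancel₀ Complex.I_ne_zero, mul_one, one_div]
  have e2 : (C (1 / 2 : ℂ) : Coord T n ℂ) * 2 = 1 := by
    rw [show (2 : Coord T n ℂ) = C 2 from (map_ofNat C 2).symm, ← map_mul]
    norm_num
  suffices h : hermSubstInv.comp hermSubst = AlgHom.id ℂ (Coord T n ℂ) from AlgHom.congr_fun h P
  refine MvPolynomial.algHom_ext fun l ↦ ?_
  obtain ⟨τ, a, b⟩ := l
  rw [AlgHom.comp_apply, AlgHom.id_apply, hermSubst, aeval_X]
  dsimp only
  rcases lt_trichotomy a b with h | rfl | h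
  · rw [if_pos h, map_add, map_mul, MvPolynomial.algHom_C, hermSubstInv, aeval_X, aeval_X]
    dsimp only
    rw [if_pos h, if_neg (not_lt.mpr h.le), if_neg (ne_of_gt h), MvPolynomial.algebraMap_eq]
    linear_combination ((X (τ, a, b) : Coord T n ℂ) - X (τ, b, a)) * e1 + (X (τ, a, b) : Coord T n ℂ) * e2
  · rw [if_neg (lt_irrefl a), if_pos rfl, hermSubstInv, aeval_X]
    dsimp only
    rw [if_neg (lt_irrefl a), if_pos rfl]
  · rw [if_neg (not_lt.mpr h.le), if_neg (ne_of_gt h), map_sub, map_mul, MvPolynomial.algHom_C,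
      hermSubstInv, aeval_X, aeval_X]
    dsimp only
    rw [if_pos h, if_neg (not_lt.mpr h.le), if_neg (ne_of_gt h), MvPolynomial.algebraMap_eq]
    linear_combination -((X (τ, b, a) : Coord T n ℂ) - X (τ, a, b)) * e1 + (X (τ, a, b) : Coord T n ℂ) * e2

/-- **Vanishing on block-Hermitian points.** If `P` is killed by all coadjoint derivations and
restricts to `0` on the diagonal, then `P` vanishes at every block-Hermitian point: conjugate each
Hermitian block to a (real) diagonal matrix by a unitary (Mathlib's spectral theorem) and use the
`GLₙ^T`-invariance of `P`. [folklore] -/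
theorem eval_hermPt_eq_zero {P : Coord T n ℂ} (hP : ∀ τ c d, coadDer τ c d P = 0)
    (hres : restrictDiag T n ℂ P = 0) (y : Idx T n → ℝ) :
    eval (hermPt fun l ↦ (y l : ℂ)) P = 0 := by
  set H : T → Matrix (Fin n) (Fin n) ℂ := fun τ ↦ Matrix.of fun a b ↦ hermPt (fun l ↦ (y l : ℂ)) (τ, a, b)
    with hH_def
  have hH : ∀ τ, (H τ).IsHermitian := fun τ ↦ isHermitian_hermPt y τ
  set U : T → Matrix (Fin n) (Fin n) ℂ := fun τ ↦ ((hH τ).eigenvectorUnitary : Matrix (Fin n) (Fin n) ℂ)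
    with hU_def
  have hUU : ∀ τ, U τ * star (U τ) = 1 := fun τ ↦ Unitary.coe_mul_star_self _
  set g : T → Matrix (Fin n) (Fin n) ℂ := fun τ ↦ star (U τ) with hg_def
  have hg : ∀ τ, (g τ).det ≠ 0 := fun τ ↦ Matrix.det_ne_zero_of_left_inverse (hUU τ)
  have hinv : ∀ τ, (g τ)⁻¹ = U τ := fun τ ↦ Matrix.inv_eq_left_inv (hUU τ)
  have hdiag : ∀ τ, g τ * H τ * (g τ)⁻¹ = diagonal (RCLike.ofReal ∘ (hH τ).eigenvalues) := by
    intro τ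
    rw [hinv, ← (hH τ).conjStarAlgAut_star_eigenvectorUnitary, Unitary.conjStarAlgAut_apply,
      Unitary.coe_star, star_star]
  -- invariance, then evaluate
  rw [← conjSubst_eq hP g hg, conjSubst, MvPolynomial.eval, aeval_eq_bind₁, eval₂Hom_bind₁]
  change eval (fun l ↦ eval (hermPt fun l ↦ (y l : ℂ)) (conjPoly g l)) P = 0
  have hq : ∀ l : Idx T n, eval (hermPt fun l ↦ (y l : ℂ)) (conjPoly g l) =
      diagonal (RCLike.ofReal ∘ (hH l.1).eigenvalues) l.2.1 l.2.2 := by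
    rintro ⟨τ, a, b⟩
    rw [← hdiag, conjPoly]
    dsimp only
    have h1 : ∀ M : Matrix (Fin n) (Fin n) (Coord T n ℂ), eval (hermPt fun l ↦ (y l : ℂ)) (M a b) =
        ((eval (hermPt fun l ↦ (y l : ℂ))).mapMatrix M) a b := fun M ↦ rfl
    have h2 : (eval (hermPt fun l ↦ (y l : ℂ))).mapMatrix (genMat (n := n) (K := ℂ) τ) = H τ := by
      refine Matrix.ext fun a' b' ↦ ?_
      rw [RingHom.mapMatrix_apply, Matrix.map_apply, genMat_apply, eval_X, hH_def]
      rfl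
    have h3 : ∀ m : Matrix (Fin n) (Fin n) ℂ, (eval (hermPt fun l ↦ (y l : ℂ))).mapMatrix (m.map C) = m :=
      fun m ↦ Matrix.ext fun a' b' ↦ eval_C _
    rw [h1, map_mul, map_mul, h3, h3, h2]
  simp_rw [hq]
  rw [eval_eq_eval_restrictDiag (fun τ a b hab ↦ ?_), hres, map_zero]
  exact diagonal_apply_ne _ hab

/-- **Chevalley restriction for `𝔤𝔩ₙ(ℂ)^T`, injectivity half (infinitesimal form).** A polynomial
`P` on `𝔤 = 𝔤𝔩ₙ(ℂ)^T` (i.e. `P ∈ S(𝔤) = ℂ[z_{τ,a,b}]`) which is invariant under the adjoint action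
of `𝔤` — killed by all the derivations `D_{E^τ_{cd}}` — and whose restriction to the diagonal
Cartan subalgebra `𝔥` vanishes, is zero. Classically (Humphreys 1972, §23.1 with the Appendix to
§23; Bourbaki LIE VIII §8.3 Th. 1): `S(𝔤)^G → S(𝔥)^W` is injective because conjugates of `𝔥` are
Zariski dense; here: `ad`-invariance integrates to `GLₙ(ℂ)^T`-invariance (transvection flows and
torus weights), every block-Hermitian matrix is unitarily diagonalisable, and a complex polynomial
vanishing on the totally real subspace of block-Hermitian matrices vanishes (grid argument).
[cite: Humphreys1972, §23.1 and Appendix to §23] -/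
theorem eq_zero_of_coadDer_eq_zero_of_restrictDiag_eq_zero (P : Coord T n ℂ)
    (hP : ∀ τ c d, coadDer τ c d P = 0) (hres : restrictDiag T n ℂ P = 0) : P = 0 := by
  classical
  set Q := hermSubst P with hQ_def
  have hQ : Q = 0 := by
    refine MvPolynomial.eq_zero_of_eval_zero_at_prod_finset Q
      (fun _ ↦ (Finset.range (Q.totalDegree + 1)).image fun j : ℕ ↦ (j : ℂ)) (fun l ↦ ?_) ?_
    · rw [Finset.card_image_of_injective _ Nat.cast_injective, Finset.card_range]
      exact Nat.lt_succ_of_le (degreeOf_le_totalDegree Q l)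
    · intro x hx
      have hx' : ∀ l, ∃ j : ℕ, x l = (j : ℂ) := fun l ↦ by
        obtain ⟨j, -, hj⟩ := Finset.mem_image.mp (hx l)
        exact ⟨j, hj.symm⟩
      choose j hj using hx'
      have hxy : x = fun l ↦ (((j l : ℕ) : ℝ) : ℂ) := by
        funext l
        rw [hj l, Complex.ofReal_natCast]
      rw [hQ_def, eval_hermSubst, hxy]
      exact eval_hermPt_eq_zero hP hres _
  rw [← hermSubstInv_hermSubst P, ← hQ_def, hQ, map_zero]

end Complex

end Literature.Algebra.Lie.ChevalleyGL
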